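import Summits.KontsevichZagierPeriods.KontsevichZagierPeriods.Theses.TerasomaMultiplication
import Literature.NumberTheory.Transcendental.KZMellinFibres
import Literature.NumberTheory.Transcendental.KZLogCalculusProofs
import Literature.Analysis.SpecialFunctions.SelbergIntegralBasic

/-!
# `MultiplicationThree` (stmt-KontsevichZagierPeriods-3598) — negative knowledge, part 1: the pinned representations

cdisprove findings on the crux `TerasomaMultiplication.MultiplicationThree` (n = 3 pure-Beta Gauss
multiplication pair), importable by ideators / planners / the lead. Here: for every rational
`s > 0` the two pinned representations EXIST as `KZ.IntegralRep 2` — `boxRep s hs`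
(semialgebraic via `KZ.isSemialgebraicFunOn_mellinIntegrand`; integrable as a product of Beta
kernels) and `simplexRep s hs` (Dirichlet integrability through the polynomial chart
`Φ(u,v) = (3u, 3(1-u)v)` of the triangle by the box, `|det DΦ| = 9(1-u)`, Jacobian criterion) — and
`multiplicationThree_iff_pinned : MultiplicationThree ↔ ∀ s hs, Equivalent (boxRep s hs) (simplexRep s hs)`.
Parts 2–4 (`ValueEq`, `Additivity`, `LoadBearing`) build on this file. (cdisprove gen 1; sorry-free,
standard axioms.)
-/

noncomputable section

open MeasureTheory Set Real
open scoped BigOperators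

namespace Summit.KontsevichZagierPeriods.TerasomaMultiplication.MultiplicationThreeNegative

open Literature.NumberTheory.Transcendental
open Literature.NumberTheory.Transcendental.KZ
open Literature.ModelTheory.ExponentialFields (IsSemialgebraic)
open MvPolynomial (aeval X C)
open Summit.KontsevichZagierPeriods.KontsevichZagierPeriods.Theses.TerasomaMultiplication
  (MultiplicationThree)

/-! ## §1 Vocabulary: the two pinned representations exist for every rational `s > 0` -/

/-- The open unit box `(0,1)²`, literally the domain clause of the crux. [folklore] -/
def box : Set (Fin 2 → ℝ) := {x | ∀ i, x i ∈ Set.Ioo (0:ℝ) 1}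

/-- The open triangle `{σ₁ > 0, σ₂ > 0, σ₁ + σ₂ < 3}`, literally the domain clause of the crux. [folklore] -/
def triangle : Set (Fin 2 → ℝ) := {x | 0 < x 0 ∧ 0 < x 1 ∧ x 0 + x 1 < 3}

/-- The box integrand `v₁^{-2/3}(1-v₁)^{s-1} v₂^{-1/3}(1-v₂)^{s-1}`, literally as in the crux. [folklore] -/
def boxFun (s : ℚ) : (Fin 2 → ℝ) → ℝ := fun x =>
  (x 0) ^ (-(2:ℝ)/3) * (1 - x 0) ^ ((s:ℝ) - 1) * (x 1) ^ (-(1:ℝ)/3) * (1 - x 1) ^ ((s:ℝ) - 1)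

/-- The simplex integrand `(σ₁σ₂(3-σ₁-σ₂))^{s-1}`, literally as in the crux. [folklore] -/
def simplexFun (s : ℚ) : (Fin 2 → ℝ) → ℝ := fun x => (x 0 * x 1 * (3 - x 0 - x 1)) ^ ((s:ℝ) - 1)

/-- The crux, unfolded over this vocabulary (by `Iff.rfl`). [folklore] -/
theorem multiplicationThree_iff :
    MultiplicationThree ↔ ∀ s : ℚ, 0 < s → ∀ (r r' : IntegralRep 2), r.domain = box →
      EqOn r.integrand (boxFun s) r.domain → r'.domain = triangle →
      EqOn r'.integrand (simplexFun s) r'.domain → Equivalent r r' :=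
  Iff.rfl

/-- The box is the product set `∏ (0,1)`. [folklore] -/
theorem box_eq_pi : box = Set.pi Set.univ fun _ : Fin 2 => Set.Ioo (0:ℝ) 1 := by
  ext x; simp [box]

/-- The box is `ℚ`-semialgebraic. [folklore] -/
theorem isSemialgebraic_box : IsSemialgebraic ℚ box := KZ.isSemialgebraic_box 2

/-- The describing polynomials of the triangle. [folklore] -/
def trianglePolys : Fin 3 → MvPolynomial (Fin 2) ℚ := ![X 0, X 1, 3 - X 0 - X 1]

/-- The triangle is cut out by `trianglePolys > 0`. [folklore] -/
theorem triangle_eq : triangle = {x | ∀ l, 0 < aeval x (trianglePolys l)} := by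
  ext x
  simp only [triangle, mem_setOf_eq, Fin.forall_fin_succ, trianglePolys,
    Matrix.cons_val_zero, Matrix.cons_val_succ, map_sub, MvPolynomial.aeval_X]
  have h3 : aeval x (3 : MvPolynomial (Fin 2) ℚ) = (3 : ℝ) := by
    rw [show (3 : MvPolynomial (Fin 2) ℚ) = C 3 by simp [map_ofNat], MvPolynomial.aeval_C]; simp
  rw [h3]
  constructor
  · rintro ⟨h0, h1, h2⟩; exact ⟨h0, h1, by linarith, fun i => Fin.elim0 i⟩
  · rintro ⟨h0, h1, h2, -⟩; exact ⟨h0, h1, by linarith⟩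

/-- The triangle is `ℚ`-semialgebraic. [folklore] -/
theorem isSemialgebraic_triangle : IsSemialgebraic ℚ triangle := by
  rw [triangle_eq]; exact isSemialgebraic_setOf_forall_aeval_pos _

/-- Measurability of the box. [folklore] -/
theorem measurableSet_box : MeasurableSet box :=
  IsSemialgebraic.measurableSet_holds isSemialgebraic_box

/-- Measurability of the triangle. [folklore] -/
theorem measurableSet_triangle : MeasurableSet triangle :=
  IsSemialgebraic.measurableSet_holds isSemialgebraic_triangle

/-- The Mellin family of the box integrand. [folklore] -/
def boxPolys : Fin 4 → MvPolynomial (Fin 2) ℚ := ![X 0, 1 - X 0, X 1, 1 - X 1]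

/-- The Mellin exponents of the box integrand. [folklore] -/
def boxExps (s : ℚ) : Fin 4 → ℚ := ![-2/3, s - 1, -1/3, s - 1]

/-- On the box the box integrand is the Euler–Mellin integrand of `(boxPolys, boxExps s, 1)`. [folklore] -/
theorem boxFun_eq_mellinIntegrand (s : ℚ) {x : Fin 2 → ℝ} :
    boxFun s x = mellinIntegrand boxPolys (boxExps s) 1 x := by
  simp only [boxFun, mellinIntegrand, Fin.prod_univ_four, boxPolys, boxExps, Matrix.cons_val_zero,
    Matrix.cons_val_one, Matrix.cons_val_two, Matrix.cons_val_three, Matrix.head_cons,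
    Matrix.tail_cons, map_sub, map_one, MvPolynomial.aeval_X, Rat.cast_one, one_mul, Rat.cast_sub, Rat.cast_div,
    Rat.cast_neg, Rat.cast_ofNat]

/-- The box integrand is `ℚ`-semialgebraic on the box (rational exponents). [folklore] -/
theorem isSemialgebraicFunOn_boxFun (s : ℚ) : IsSemialgebraicFunOn ℚ box (boxFun s) := by
  refine (isSemialgebraicFunOn_mellinIntegrand isSemialgebraic_box boxPolys (boxExps s) 1
    ?_).congr fun x _ => (boxFun_eq_mellinIntegrand s).symm
  intro x hx k
  have h0 := hx 0
  have h1 := hx 1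
  fin_cases k <;> simp [boxPolys, h0.1, h1.1, h0.2, h1.2]

/-- The Mellin family of the simplex integrand. [folklore] -/
def simplexPolys : Fin 1 → MvPolynomial (Fin 2) ℚ := ![X 0 * X 1 * (3 - X 0 - X 1)]

/-- On the triangle the simplex integrand is the Euler–Mellin integrand of `(simplexPolys, s-1, 1)`. [folklore] -/
theorem simplexFun_eq_mellinIntegrand (s : ℚ) {x : Fin 2 → ℝ} :
    simplexFun s x = mellinIntegrand simplexPolys ![s - 1] 1 x := by
  have h3 : aeval x (3 : MvPolynomial (Fin 2) ℚ) = (3 : ℝ) := by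
    rw [show (3 : MvPolynomial (Fin 2) ℚ) = C 3 by simp [map_ofNat], MvPolynomial.aeval_C]; simp
  simp only [simplexFun, mellinIntegrand, Fin.prod_univ_one, simplexPolys, Matrix.cons_val_zero,
    map_sub, map_mul, MvPolynomial.aeval_X, h3, Rat.cast_one, one_mul, Rat.cast_sub]

/-- The simplex integrand is `ℚ`-semialgebraic on the triangle. [folklore] -/
theorem isSemialgebraicFunOn_simplexFun (s : ℚ) : IsSemialgebraicFunOn ℚ triangle (simplexFun s) := by
  refine (isSemialgebraicFunOn_mellinIntegrand isSemialgebraic_triangle simplexPolys ![s - 1] 1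
    ?_).congr fun x _ => (simplexFun_eq_mellinIntegrand s).symm
  intro x hx k
  have h3 : aeval x (3 : MvPolynomial (Fin 2) ℚ) = (3 : ℝ) := by
    rw [show (3 : MvPolynomial (Fin 2) ℚ) = C 3 by simp [map_ofNat], MvPolynomial.aeval_C]; simp
  fin_cases k
  simp only [simplexPolys, Fin.zero_eta, Matrix.cons_val_zero, map_mul, map_sub, MvPolynomial.aeval_X, h3]
  obtain ⟨h0, h1, h2⟩ := hx
  exact mul_pos (mul_pos h0 h1) (by linarith)

/-! ### Integrability and the box representation -/

/-- Lebesgue measure restricted to the box is the product of the restricted measures. [folklore] -/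
theorem volume_restrict_box :
    (volume : Measure (Fin 2 → ℝ)).restrict box =
      Measure.pi fun _ : Fin 2 => (volume : Measure ℝ).restrict (Ioo (0:ℝ) 1) := by
  rw [box_eq_pi, volume_pi, Measure.restrict_pi_pi]

/-- Euler's Beta kernel `t^{a-1}(1-t)^{b-1}` is integrable on `(0,1)` for `a, b > 0` (tree lemma,
exponent form). [folklore] -/
theorem integrableOn_beta {a b : ℝ} (ha : 0 < a) (hb : 0 < b) :
    IntegrableOn (fun t : ℝ => t ^ (a - 1) * (1 - t) ^ (b - 1)) (Ioo 0 1) :=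
  (Literature.Analysis.SpecialFunctions.Selberg.integrableOn_Ioo_rpow_mul_one_sub_rpow_and_integral_eq
    ha hb).1

/-- The one-variable factors of the box integrand. [folklore] -/
def boxFactor (s : ℚ) : Fin 2 → ℝ → ℝ :=
  ![fun t => t ^ (-(2:ℝ)/3) * (1 - t) ^ ((s:ℝ) - 1), fun t => t ^ (-(1:ℝ)/3) * (1 - t) ^ ((s:ℝ) - 1)]

/-- The box integrand is the product of its factors. [folklore] -/
theorem boxFun_eq_prod (s : ℚ) (x : Fin 2 → ℝ) : boxFun s x = ∏ i, boxFactor s i (x i) := by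
  simp only [boxFun, boxFactor, Fin.prod_univ_two, Matrix.cons_val_zero, Matrix.cons_val_one]
  ring

/-- Each factor is Beta-integrable for `s > 0`. [folklore] -/
theorem integrable_boxFactor {s : ℚ} (hs : 0 < s) (i : Fin 2) :
    Integrable (boxFactor s i) ((volume : Measure ℝ).restrict (Ioo (0:ℝ) 1)) := by
  have hsR : (0:ℝ) < s := by exact_mod_cast hs
  fin_cases i
  · have h := integrableOn_beta (a := 1/3) (b := s) (by norm_num) hsR
    refine (h.congr_fun (fun t _ => ?_) measurableSet_Ioo)
    simp only [boxFactor]; norm_num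
  · have h := integrableOn_beta (a := 2/3) (b := s) (by norm_num) hsR
    refine (h.congr_fun (fun t _ => ?_) measurableSet_Ioo)
    simp only [boxFactor]; norm_num

/-- The box integrand is absolutely integrable on the box for every rational `s > 0`. [folklore] -/
theorem integrableOn_boxFun {s : ℚ} (hs : 0 < s) : IntegrableOn (boxFun s) box := by
  rw [IntegrableOn, volume_restrict_box]
  have h := Integrable.fintype_prod (f := boxFactor s)
    (μ := fun _ : Fin 2 => (volume : Measure ℝ).restrict (Ioo (0:ℝ) 1)) (integrable_boxFactor hs)
  exact h.congr (ae_of_all _ fun x => (boxFun_eq_prod s x).symm)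

/-- **The pinned box representation** `[ (0,1)², v₁^{-2/3}(1-v₁)^{s-1}v₂^{-1/3}(1-v₂)^{s-1} ]`
for rational `s > 0`: the hypotheses `hr`, `hri` of the crux are satisfiable. [folklore] -/
def boxRep (s : ℚ) (hs : 0 < s) : IntegralRep 2 where
  domain := box
  integrand := boxFun s
  isSemialgebraic_domain := isSemialgebraic_box
  isSemialgebraicFunOn_integrand := isSemialgebraicFunOn_boxFun s
  integrableOn := integrableOn_boxFun hs


/-! ### The chart `Φ(u,v) = (3u, 3(1-u)v)` of the triangle by the box (affine in each fibre) -/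

/-- The chart `Φ(u, v) = (3u, 3(1 - u)v)`: a polynomial bijection of the open box onto the open
triangle, with Jacobian determinant `9(1 - u)`. [folklore] -/
def Φ (x : Fin 2 → ℝ) : Fin 2 → ℝ := ![3 * x 0, 3 * (1 - x 0) * x 1]

/-- First component of the chart. [folklore] -/
@[simp] theorem Φ_apply_zero (x : Fin 2 → ℝ) : Φ x 0 = 3 * x 0 := rfl

/-- Second component of the chart. [folklore] -/
@[simp] theorem Φ_apply_one (x : Fin 2 → ℝ) : Φ x 1 = 3 * (1 - x 0) * x 1 := rfl

/-- The Jacobian matrix of the chart. [folklore] -/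
def jac (x : Fin 2 → ℝ) : Matrix (Fin 2) (Fin 2) ℝ := !![3, 0; -(3 * x 1), 3 * (1 - x 0)]

/-- The derivative of the chart as a continuous linear map. [folklore] -/
def Φ' (x : Fin 2 → ℝ) : (Fin 2 → ℝ) →L[ℝ] (Fin 2 → ℝ) :=
  LinearMap.toContinuousLinearMap (Matrix.toLin' (jac x))

/-- The derivative applied to a vector, first component. [folklore] -/
@[simp] theorem Φ'_apply_zero (x v : Fin 2 → ℝ) : Φ' x v 0 = 3 * v 0 := by
  change Matrix.toLin' (jac x) v 0 = _
  rw [Matrix.toLin'_apply]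
  simp [jac, Matrix.mulVec, dotProduct, Fin.sum_univ_two]

/-- The derivative applied to a vector, second component. [folklore] -/
@[simp] theorem Φ'_apply_one (x v : Fin 2 → ℝ) :
    Φ' x v 1 = -(3 * x 1) * v 0 + 3 * (1 - x 0) * v 1 := by
  change Matrix.toLin' (jac x) v 1 = _
  rw [Matrix.toLin'_apply]
  simp [jac, Matrix.mulVec, dotProduct, Fin.sum_univ_two]

/-- `det DΦ(u,v) = 9(1 - u)`. [folklore] -/
theorem det_Φ' (x : Fin 2 → ℝ) : (Φ' x).det = 9 * (1 - x 0) := by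
  change LinearMap.det (Matrix.toLin' (jac x)) = _
  rw [LinearMap.det_toLin', Matrix.det_fin_two]
  simp [jac]
  ring

/-- The chart is differentiable with derivative `Φ'`. [folklore] -/
theorem hasFDerivAt_Φ (x : Fin 2 → ℝ) : HasFDerivAt Φ (Φ' x) x := by
  have h0 : HasFDerivAt (fun y : Fin 2 → ℝ => y 0)
      (ContinuousLinearMap.proj (R := ℝ) (φ := fun _ : Fin 2 => ℝ) 0) x :=
    hasFDerivAt_apply 0 x
  have h1 : HasFDerivAt (fun y : Fin 2 → ℝ => y 1)
      (ContinuousLinearMap.proj (R := ℝ) (φ := fun _ : Fin 2 => ℝ) 1) x :=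
    hasFDerivAt_apply 1 x
  rw [hasFDerivAt_pi']
  refine Fin.forall_fin_two.mpr ⟨?_, ?_⟩
  · have hf : (fun y : Fin 2 → ℝ => Φ y 0) = fun y => 3 * y 0 := funext fun y => rfl
    rw [hf]
    refine (h0.const_mul (3:ℝ)).congr_fderiv (ContinuousLinearMap.ext fun v => ?_)
    simp
  · have hf : (fun y : Fin 2 → ℝ => Φ y 1) = fun y => 3 * (1 - y 0) * y 1 := funext fun y => rfl
    rw [hf]
    refine (((h0.const_sub 1).const_mul (3:ℝ)).mul h1).congr_fderiv
      (ContinuousLinearMap.ext fun v => ?_)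
    simp
    ring

/-- The chart is injective on the box. [folklore] -/
theorem injOn_Φ : InjOn Φ box := by
  intro x hx y hy hxy
  have h0 : x 0 = y 0 := by
    have := congrFun hxy 0
    simp only [Φ_apply_zero] at this
    linarith
  have h1 : x 1 = y 1 := by
    have := congrFun hxy 1
    simp only [Φ_apply_one, h0] at this
    have hne : (3 : ℝ) * (1 - y 0) ≠ 0 := by have := (hy 0).2; positivity
    exact mul_left_cancel₀ hne this
  funext i
  fin_cases i
  · exact h0
  · exact h1

/-- The chart maps the box ONTO the triangle. [folklore] -/
theorem image_Φ_box : Φ '' box = triangle := by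
  ext y
  constructor
  · rintro ⟨x, hx, rfl⟩
    have h0 := hx 0
    have h1 := hx 1
    refine ⟨by simp; exact h0.1, by simp; exact mul_pos (by linarith [h0.2]) h1.1, ?_⟩
    simp only [Φ_apply_zero, Φ_apply_one]
    nlinarith [h0.1, h0.2, h1.1, h1.2, mul_pos (sub_pos.2 h0.2) (sub_pos.2 h1.2)]
  · rintro ⟨hy0, hy1, hy2⟩
    have h3 : 0 < 3 - y 0 := by linarith
    refine ⟨![y 0 / 3, y 1 / (3 - y 0)], Fin.forall_fin_two.mpr ⟨?_, ?_⟩, ?_⟩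
    · change y 0 / 3 ∈ Ioo (0:ℝ) 1
      exact ⟨by positivity, by rw [div_lt_one (by norm_num)]; linarith⟩
    · change y 1 / (3 - y 0) ∈ Ioo (0:ℝ) 1
      exact ⟨div_pos hy1 h3, by rw [div_lt_one h3]; linarith⟩
    · funext i
      fin_cases i
      · change 3 * (y 0 / 3) = y 0
        ring
      · change 3 * (1 - y 0 / 3) * (y 1 / (3 - y 0)) = y 1
        field_simp

/-- `|det DΦ| = 9(1 - u) > 0` on the box. [folklore] -/
theorem abs_det_Φ' {x : Fin 2 → ℝ} (hx : x ∈ box) : |(Φ' x).det| = 9 * (1 - x 0) := by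
  rw [det_Φ', abs_of_pos]
  have := (hx 0).2
  linarith

/-- The pulled-back factors: the box integrand of `9·27^{s-1}·B(s,2s)B(s,s)`. [folklore] -/
def pullFactor (s : ℚ) : Fin 2 → ℝ → ℝ :=
  ![fun t => t ^ ((s:ℝ) - 1) * (1 - t) ^ (2 * (s:ℝ) - 1), fun t => t ^ ((s:ℝ) - 1) * (1 - t) ^ ((s:ℝ) - 1)]

/-- The constant `9 · 27^{s-1}` of the pull-back. [folklore] -/
def pullConst (s : ℚ) : ℝ := 9 * (27:ℝ) ^ ((s:ℝ) - 1)

/-- **The pull-back identity**: on the box,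
`|det DΦ| · (σ₁σ₂(3-σ₁-σ₂))^{s-1} ∘ Φ = 9·27^{s-1} · u^{s-1}(1-u)^{2s-1} · v^{s-1}(1-v)^{s-1}`
(the fibre of `Φ` over `σ₁ = 3u` is the segment `σ₂ ∈ (0, 3(1-u))`, and
`3 - 3u - 3(1-u)v = 3(1-u)(1-v)`). [folklore] -/
theorem pullback_eq {s : ℚ} {x : Fin 2 → ℝ} (hx : x ∈ box) :
    |(Φ' x).det| * simplexFun s (Φ x) = pullConst s * ∏ i, pullFactor s i (x i) := by
  have hu0 : 0 < x 0 := (hx 0).1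
  have hu1 : 0 < 1 - x 0 := sub_pos.2 (hx 0).2
  have hv0 : 0 < x 1 := (hx 1).1
  have hv1 : 0 < 1 - x 1 := sub_pos.2 (hx 1).2
  rw [abs_det_Φ' hx]
  simp only [simplexFun, Φ_apply_zero, Φ_apply_one, pullConst, pullFactor, Fin.prod_univ_two,
    Matrix.cons_val_zero, Matrix.cons_val_one]
  have hbase : 3 * x 0 * (3 * (1 - x 0) * x 1) * (3 - 3 * x 0 - 3 * (1 - x 0) * x 1) =
      27 * (x 0 * ((1 - x 0) ^ (2:ℝ) * (x 1 * (1 - x 1)))) := by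
    rw [Real.rpow_two]; ring
  rw [hbase, Real.mul_rpow (by norm_num) (by positivity), Real.mul_rpow hu0.le (by positivity),
    Real.mul_rpow (by positivity) (by positivity), Real.mul_rpow hv0.le hv1.le,
    ← Real.rpow_mul hu1.le]
  have h2 : (1 - x 0) ^ (2 * ((s:ℝ) - 1)) * (1 - x 0) = (1 - x 0) ^ (2 * (s:ℝ) - 1) := by
    rw [← Real.rpow_add_one hu1.ne']
    ring_nf
  rw [← h2]
  ring

/-- Each pulled-back factor is Beta-integrable for `s > 0`. [folklore] -/
theorem integrable_pullFactor {s : ℚ} (hs : 0 < s) (i : Fin 2) :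
    Integrable (pullFactor s i) ((volume : Measure ℝ).restrict (Ioo (0:ℝ) 1)) := by
  have hsR : (0:ℝ) < s := by exact_mod_cast hs
  fin_cases i
  · have h := integrableOn_beta (a := s) (b := 2 * s) hsR (by positivity)
    refine (h.congr_fun (fun t _ => ?_) measurableSet_Ioo)
    simp only [pullFactor]
    norm_num
  · exact integrableOn_beta (a := s) (b := s) hsR hsR

/-- The pulled-back integrand is integrable on the box. [folklore] -/
theorem integrableOn_pullback {s : ℚ} (hs : 0 < s) :
    IntegrableOn (fun x => pullConst s * ∏ i, pullFactor s i (x i)) box := by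
  rw [IntegrableOn, volume_restrict_box]
  exact (Integrable.fintype_prod (f := pullFactor s)
    (μ := fun _ : Fin 2 => (volume : Measure ℝ).restrict (Ioo (0:ℝ) 1))
    (integrable_pullFactor hs)).const_mul _

/-- **The simplex integrand is absolutely integrable on the triangle** for every rational `s > 0`
(Dirichlet's integral, here by the chart `Φ` and Mathlib's Jacobian criterion
`integrableOn_image_iff_integrableOn_abs_det_fderiv_smul`). [folklore] -/
theorem integrableOn_simplexFun {s : ℚ} (hs : 0 < s) : IntegrableOn (simplexFun s) triangle := by
  rw [← image_Φ_box]
  rw [integrableOn_image_iff_integrableOn_abs_det_fderiv_smul volume measurableSet_box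
    (fun x _ => (hasFDerivAt_Φ x).hasFDerivWithinAt) injOn_Φ]
  refine (integrableOn_pullback hs).congr_fun (fun x hx => ?_) measurableSet_box
  rw [smul_eq_mul, pullback_eq hx]

/-- **The pinned simplex representation** `[ triangle, (σ₁σ₂(3-σ₁-σ₂))^{s-1} ]` for rational
`s > 0`: the hypotheses `hr'`, `hri'` of the crux are satisfiable. [folklore] -/
def simplexRep (s : ℚ) (hs : 0 < s) : IntegralRep 2 where
  domain := triangle
  integrand := simplexFun s
  isSemialgebraic_domain := isSemialgebraic_triangle
  isSemialgebraicFunOn_integrand := isSemialgebraicFunOn_simplexFun s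
  integrableOn := integrableOn_simplexFun hs

/-- **Non-vacuity and reduction to one pair.** The crux is equivalent to its instance on the two
pinned representations: any two representations satisfying the four pinning hypotheses differ from
`boxRep s`, `simplexRep s` by integrand additivity with a zero representation
(`KZ.of_sub_of_mem_relations_of_eqOn`). A prover may fix `r := boxRep s hs`, `r' := simplexRep s hs`.
[folklore] -/
theorem multiplicationThree_iff_pinned :
    MultiplicationThree ↔ ∀ (s : ℚ) (hs : 0 < s), Equivalent (boxRep s hs) (simplexRep s hs) := by
  constructor
  · intro h s hs
    exact h s hs (boxRep s hs) (simplexRep s hs) rfl (fun _ _ => rfl) rfl (fun _ _ => rfl)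
  · intro h s hs r r' hr hri hr' hri'
    have h1 : of r - of (boxRep s hs) ∈ relations :=
      of_sub_of_mem_relations_of_eqOn (by rw [hr]; rfl) hri
    have h2 : of (simplexRep s hs) - of r' ∈ relations :=
      of_sub_of_mem_relations_of_eqOn (by rw [hr']; rfl) fun x hx => (hri' (by rw [hr']; exact hx)).symm
    have : of r - of r' = (of r - of (boxRep s hs)) + (of (boxRep s hs) - of (simplexRep s hs)) +
        (of (simplexRep s hs) - of r') := by abel
    show of r - of r' ∈ relations
    rw [this]
    exact relations.add_mem (relations.add_mem h1 (h s hs)) h2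

end Summit.KontsevichZagierPeriods.TerasomaMultiplication.MultiplicationThreeNegative
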